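import Summits.RiemannHypothesis.RiemannHypothesis.Theorems.PfPersistenceBarrierExplicitDatum
import Summits.RiemannHypothesis.RiemannHypothesis.Theorems.PfPersistenceLocalityBarrier
import Literature.NumberTheory.LFunctions.WeilGroundEnergyParitySplit
import Literature.NumberTheory.LFunctions.WeilTwoPrimePos59
import HarnessLib

/-!
# PF persistence, fake seat 4 — the DOWN-CONE NODAL FORCING lemma (random multiplicative twists)

Unit `pub-rhpf-fake-4` of the `pub-rhpf` cell (mechanism / rigidity campaign; **no RH claims**).

A RANDOM MULTIPLICATIVE FUNCTION fake of `ζ` is the explicit-formula datum with `ζ`'s smooth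
(polar + archimedean) part and point masses `f(n) Λ(n)/√n` at `± log n`, `f` completely
multiplicative with `f(p) ∈ {±1}` (Rademacher) — more generally any real TWIST TABLE `f` with
`f(n) ≤ 1`, which also covers prime DELETIONS (`f = 0` on the deleted prime powers) and the
observatory's `F₋`-DIALS (`f(p) = K ≤ 1`).  All of these lie in the DOWN-CONE of `ζ`'s weight
table `w_ζ(n) = Λ(n)/√n`: weight tables `w' ≤ w_ζ` pointwise (`twistTable_le_zetaTable`).

**The lemma (PROVED here, unconditional).**  For every window `a`, every down-cone table
`w' ≤ w_ζ` and every REAL test function `f` supported in `[-a, a]` that is ONE-SIGNED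
(`f ≥ 0` or `f ≤ 0`),

`Re Q_ζ(f) ≤ Re Q_{w'}(f)`                                   (`re_weilQuadratic_le_of_oneSigned`),

because `Q_{w'}(f) − Q_ζ(f) = Σ_{n ≤ e^{2a}} (w_ζ(n) − w'(n)) (k(log n) + k(−log n))` with
`k = f ⋆ f̃` the autocorrelation of `f`, which is pointwise `≥ 0` for one-signed `f`
(`re_weilConv_weilReflect_ofReal_nonneg`).  Consequences:

* (ENERGY FORM) `ε(a) ‖f‖² ≤ Re Q_{w'}(f)` and, for even `f`, `ε_ev(a) ‖f‖² ≤ Re Q_{w'}(f)` for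
  one-signed `f` (`weilGroundEnergy_mul_le_re_quadratic_of_oneSigned`,
  `weilEvenGroundEnergy_mul_le_re_quadratic_of_oneSigned`): a one-signed state of a down-cone
  fake never has energy below `ζ`'s ground energy of the same window;
* (NODAL FORCING) if a real window test `f` has `Re Q_{w'}(f) < Re Q_ζ(f)` — in particular
  `Re Q_{w'}(f) < ε(a) ‖f‖²`, or `Re Q_{w'}(f) < 0` at a window where `Q_ζ ≥ 0` — then `f`
  CHANGES SIGN (`sign_change_of_re_quadratic_lt`, `…_lt_groundEnergy`, `…_neg_of_weilPositivityOn`);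
  unconditionally so for `a ≤ 59/100` (`sign_change_of_re_quadratic_neg_59_100`, from the tree's
  `weilPositivityOn_59_100`), and at every window under RH.

So on the whole down-cone (sign twists, deletions, `F₋` dials) the direction in which window
positivity fails is NODAL: the shape primitive "ground state one-signed" (GAP-CLASSES S3-I1) is
SOUND against every down-cone fake at every window where `ζ` itself is window-positive, and the
pair ("one-signed", "`ε₁ ≥ ε₁^ζ`") is sound at every window unconditionally.  This is the
continuum form of FRAMING §3a's observation that nodal-at-flip is direction-dependent: for `F₋`
it is forced, for `F₊` (up-cone) nothing is claimed.  It does NOT touch the twin wall W1: a twist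
with `f(n) = 1` for `log n ≤ 2a` has the SAME window-`a` data as `ζ` (`agreeBelow_tableDatum`
with the tree's `quadratic_eq_of_agreeBelow`), so the first window at which an RMF fake can be
seen is `a > (log p₁)/2`, `p₁` the least prime with `f(p₁) ≠ 1`; the lemma says what is seen there.

The Galerkin (matrix) version over `PfPersistence.evenBlock` needs the integral representation
`Σ v_n v_m θ_{nm}(y) = ∫ θ_v(x) θ_v(x+y) dx` of `thetaEven`, not in the tree (the same missing
input as `PfPersistence.PrimePatternFormBounded`); it is not attempted here.

References: A. Weil 1952 (the quadratic functional); E. Bombieri, Rend. Mat. Acc. Lincei (9) 11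
(2000), Thm 2 and §4 (ground energies `μ^±(M)`); H. Yoshida, Adv. Stud. Pure Math. 21 (1992) §2;
A. Harper, Forum Math. Pi 8 (2020) e1, arXiv:1703.06654 (random multiplicative functions — only the model, no result of
that paper is used).
-/

set_option linter.dupNamespace false  -- the mandated namespace repeats `RiemannHypothesis`

noncomputable section

open MeasureTheory Set Filter Complex
open scoped Real Topology ComplexConjugate ContDiff

namespace Summit.RiemannHypothesis.RiemannHypothesis.Theorems.PfPersistenceDownCone

open Literature.NumberTheory.LFunctions
open Summit.RiemannHypothesis.RiemannHypothesis.Theorems.PfPersistenceBarrier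
open Summit.RiemannHypothesis.RiemannHypothesis.Theorems.PfPersistenceBarrier.ExplicitDatum

variable {a : ℝ}

/-! ## §1 Weight tables, twists, and their explicit-formula data -/

/-- `ζ`'s weight table `w_ζ(n) = Λ(n)/√n` (real; the tree's `weilPrimeTerm` masses). [cite: Bombieri2000Weil, Thm 2 (p. 193)] -/
def zetaTable : ℕ → ℝ := fun n ↦ (ArithmeticFunction.vonMangoldt n : ℝ) / Real.sqrt n

/-- `w_ζ ≥ 0`. [folklore] -/
theorem zetaTable_nonneg (n : ℕ) : 0 ≤ zetaTable n :=
  div_nonneg ArithmeticFunction.vonMangoldt_nonneg (Real.sqrt_nonneg _)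

/-- The TWISTED TABLE `f(n) w_ζ(n)` of a real twist `f : ℕ → ℝ` (RMF: `f` completely multiplicative,
`f(p) = ±1`; deletion: `f = 0` on the deleted prime powers; `F₋`/`F₊` dial at `p`: `f(p) = K`). [folklore] -/
def twistTable (f : ℕ → ℝ) : ℕ → ℝ := fun n ↦ f n * zetaTable n

/-- The trivial twist is `ζ`. [folklore] -/
theorem twistTable_one : twistTable (fun _ ↦ 1) = zetaTable := by
  funext n; simp [twistTable]

/-- **Down-cone membership**: a twist with `f ≤ 1` (every `±1`-valued `f`, every deletion, every
`F₋` dial) gives a table below `ζ`'s, pointwise. [folklore] -/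
theorem twistTable_le_zetaTable {f : ℕ → ℝ} (hf : ∀ n, f n ≤ 1) (n : ℕ) :
    twistTable f n ≤ zetaTable n := by
  calc twistTable f n = f n * zetaTable n := rfl
    _ ≤ 1 * zetaTable n := mul_le_mul_of_nonneg_right (hf n) (zetaTable_nonneg n)
    _ = zetaTable n := one_mul _

/-- `|f| ≤ 1` suffices (Rademacher / Steinhaus-modulus twists). [folklore] -/
theorem twistTable_le_zetaTable_of_abs {f : ℕ → ℝ} (hf : ∀ n, |f n| ≤ 1) (n : ℕ) :
    twistTable f n ≤ zetaTable n :=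
  twistTable_le_zetaTable (fun n ↦ (le_abs_self _).trans (hf n)) n

/-- The table is the admissible-class layer's `zetaWeights` (`Λ(q) q^{-1/2}`, `PfPersistenceAdmissibleClass`):
the continuum statements below apply verbatim to the weight tables of the Galerkin layer. [folklore] -/
theorem zetaTable_eq_zetaWeights : zetaTable = PfPersistence.zetaWeights := by
  funext n
  simp only [zetaTable, PfPersistence.zetaWeights, div_eq_mul_inv,
    Real.rpow_neg (Nat.cast_nonneg n), Real.sqrt_eq_rpow]

/-- **`F₋` dials are down-cone**: the observatory's one-prime dial `dial p K w_ζ` with `K ≤ 1`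
(`PfPersistenceLocalityBarrier.dial`) lies below `w_ζ`. [folklore] -/
theorem dial_le_zetaTable {p : ℕ} {K : ℝ} (hK : K ≤ 1) (n : ℕ) :
    PfPersistence.dial p K PfPersistence.zetaWeights n ≤ zetaTable n := by
  rw [← zetaTable_eq_zetaWeights]
  unfold PfPersistence.dial
  split_ifs with h
  · calc K * zetaTable n ≤ 1 * zetaTable n := mul_le_mul_of_nonneg_right hK (zetaTable_nonneg n)
      _ = zetaTable n := one_mul _
  · exact le_rfl

/-- The table with the prime powers in `S` DELETED. [folklore] -/
def deleteTable (S : Set ℕ) : ℕ → ℝ := fun n ↦ by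
  classical exact if n ∈ S then 0 else zetaTable n

/-- **Deletions are down-cone.** [folklore] -/
theorem deleteTable_le_zetaTable (S : Set ℕ) (n : ℕ) : deleteTable S n ≤ zetaTable n := by
  unfold deleteTable
  split_ifs
  · exact zetaTable_nonneg n
  · exact le_rfl

/-- The explicit-formula datum of a real weight table `w`: `ζ`'s smooth part (polar + archimedean),
masses `w(n)` at `± log n`. [folklore] -/
def tableDatum (w : ℕ → ℝ) : ExplicitDatum where
  smooth k := weilPolarTerm k + weilArchTerm k
  pos n := Real.log n
  wt n := (w n : ℂ)

/-- All table data share `ζ`'s smooth part. [folklore] -/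
theorem tableDatum_smooth (w w' : ℕ → ℝ) : (tableDatum w).smooth = (tableDatum w').smooth := rfl

/-- The prime term of `ζ`'s table is the tree's `weilPrimeTerm`. [folklore] -/
theorem tableDatum_zetaTable_primeTerm (k : ℝ → ℂ) :
    (tableDatum zetaTable).primeTerm k = weilPrimeTerm k := by
  unfold ExplicitDatum.primeTerm weilPrimeTerm
  refine tsum_congr fun n ↦ ?_
  simp only [tableDatum, zetaTable]
  push_cast
  ring

/-- `Q` of `ζ`'s table is Weil's quadratic functional `weilQuadratic`. [folklore] -/
theorem tableDatum_zetaTable_quadratic (g : ℝ → ℂ) :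
    (tableDatum zetaTable).quadratic g = weilQuadratic g := by
  unfold ExplicitDatum.quadratic ExplicitDatum.functional weilQuadratic weilFunctional
  rw [tableDatum_zetaTable_primeTerm]
  simp only [tableDatum]
  ring

/-- Tables that coincide at all `n` with `log n ≤ B` give data agreeing below `B` (so, by the
tree's `quadratic_eq_of_agreeBelow`, identical window records at every `a ≤ B/2`: the twin wall W1
is untouched — an RMF twist is first visible at `a > (log p₁)/2`). [folklore] -/
theorem agreeBelow_tableDatum {w w' : ℕ → ℝ} {B : ℝ}
    (h : ∀ n : ℕ, |Real.log n| ≤ B → w n = w' n) :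
    AgreeBelow (tableDatum w) (tableDatum w') B := by
  intro i
  by_cases hi : |Real.log i| ≤ B
  · exact Or.inr ⟨rfl, by simp only [tableDatum, h i hi]⟩
  · exact Or.inl ⟨Or.inr (not_le.1 hi), Or.inr (not_le.1 hi)⟩

/-- In particular a twist with `f(n) = 1` whenever `log n ≤ B` agrees with `ζ` below `B`. [folklore] -/
theorem agreeBelow_twistTable {f : ℕ → ℝ} {B : ℝ} (h : ∀ n : ℕ, |Real.log n| ≤ B → f n = 1) :
    AgreeBelow (tableDatum zetaTable) (tableDatum (twistTable f)) B :=
  agreeBelow_tableDatum fun n hn ↦ by simp only [twistTable, h n hn, one_mul]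

/-- Hence identical window records up to `a ≤ B/2`. [folklore] -/
theorem twistTable_quadratic_eq_of_agree {f : ℕ → ℝ} {A : ℝ}
    (h : ∀ n : ℕ, |Real.log n| ≤ 2 * A → f n = 1) (ha : a ≤ A) {g : ℝ → ℂ}
    (hg : tsupport g ⊆ Icc (-a) a) :
    (tableDatum (twistTable f)).quadratic g = weilQuadratic g := by
  rw [← tableDatum_zetaTable_quadratic]
  exact (quadratic_eq_of_agreeBelow (agreeBelow_twistTable h) rfl ha hg).symm

/-! ## §2 On a window only finitely many masses enter -/

/-- For continuous `k` supported in `[-log (N+1), log (N+1)]` the table sum is the finite sum over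
`n ≤ N` (as the tree's `weilPrimeTerm_eq_sum_of_tsupport_subset`, for a general table). [folklore] -/
theorem tsum_table_eq_sum (w : ℕ → ℝ) {k : ℝ → ℂ} (hk : Continuous k) (N : ℕ)
    (hsupp : tsupport k ⊆ Icc (-Real.log ((N : ℝ) + 1)) (Real.log ((N : ℝ) + 1))) :
    ∑' n : ℕ, (w n : ℂ) * (k (Real.log n) + k (-Real.log n)) =
      ∑ n ∈ Finset.range (N + 1), (w n : ℂ) * (k (Real.log n) + k (-Real.log n)) := by
  have hIoo : Function.support k ⊆ Ioo (-Real.log ((N : ℝ) + 1)) (Real.log ((N : ℝ) + 1)) :=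
    support_subset_Ioo_of_tsupport_subset_Icc hk hsupp
  have hzero : ∀ x : ℝ, Real.log ((N : ℝ) + 1) ≤ |x| → k x = 0 := by
    intro x hx
    by_contra hne
    have hmem := hIoo (Function.mem_support.2 hne)
    rw [mem_Ioo] at hmem
    have : |x| < Real.log ((N : ℝ) + 1) := abs_lt.2 ⟨hmem.1, hmem.2⟩
    linarith
  have hfin : ∀ n ∉ Finset.range (N + 1),
      (w n : ℂ) * (k (Real.log n) + k (-Real.log n)) = 0 := by
    intro n hn
    rw [Finset.mem_range, not_lt] at hn
    have hn' : (N : ℝ) + 1 ≤ n := by exact_mod_cast hn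
    have hlog : Real.log ((N : ℝ) + 1) ≤ Real.log n := Real.log_le_log (by positivity) hn'
    have hpos : 0 ≤ Real.log n := (Real.log_nonneg (by linarith)).trans hlog
    rw [hzero _ (by rwa [abs_of_nonneg hpos]), hzero _ (by rwa [abs_neg, abs_of_nonneg hpos])]
    simp
  exact tsum_eq_sum hfin

/-- `Q_w(g)` on the window `[-(log (N+1))/2, (log (N+1))/2]`: smooth part minus the FINITE mass sum
over `n ≤ N`. [folklore] -/
theorem tableDatum_quadratic_eq_sum (w : ℕ → ℝ) {g : ℝ → ℂ} (hg : IsWeilTest g) (N : ℕ)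
    (hsupp : tsupport g ⊆ Icc (-(Real.log ((N : ℝ) + 1) / 2)) (Real.log ((N : ℝ) + 1) / 2)) :
    (tableDatum w).quadratic g =
      weilPolarTerm (weilConv g (weilReflect g)) + weilArchTerm (weilConv g (weilReflect g)) -
        ∑ n ∈ Finset.range (N + 1), (w n : ℂ) *
          (weilConv g (weilReflect g) (Real.log n) + weilConv g (weilReflect g) (-Real.log n)) := by
  have hk : IsWeilTest (weilConv g (weilReflect g)) := hg.weilConv hg.weilReflect
  have hks : tsupport (weilConv g (weilReflect g)) ⊆
      Icc (-Real.log ((N : ℝ) + 1)) (Real.log ((N : ℝ) + 1)) := by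
    have h := tsupport_weilConv_weilReflect_subset (a := Real.log ((N : ℝ) + 1) / 2) hg.2 hsupp
    rwa [show 2 * (Real.log ((N : ℝ) + 1) / 2) = Real.log ((N : ℝ) + 1) by ring] at h
  unfold ExplicitDatum.quadratic ExplicitDatum.functional ExplicitDatum.primeTerm
  simp only [tableDatum]
  rw [tsum_table_eq_sum w hk.1.continuous N hks]

/-- **Difference of two tables on a window**:
`Q_{w'}(g) = Q_w(g) + Σ_{n ≤ N} (w(n) − w'(n)) (k(log n) + k(−log n))`, `k = g ⋆ g̃`. [folklore] -/
theorem tableDatum_quadratic_eq_add_sum (w w' : ℕ → ℝ) {g : ℝ → ℂ} (hg : IsWeilTest g) (N : ℕ)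
    (hsupp : tsupport g ⊆ Icc (-(Real.log ((N : ℝ) + 1) / 2)) (Real.log ((N : ℝ) + 1) / 2)) :
    (tableDatum w').quadratic g = (tableDatum w).quadratic g +
      ∑ n ∈ Finset.range (N + 1), ((w n - w' n : ℝ) : ℂ) *
        (weilConv g (weilReflect g) (Real.log n) + weilConv g (weilReflect g) (-Real.log n)) := by
  rw [tableDatum_quadratic_eq_sum w' hg N hsupp, tableDatum_quadratic_eq_sum w hg N hsupp]
  push_cast
  simp only [sub_mul, Finset.sum_sub_distrib]
  ring

/-- Every window `[-a, a]` sits inside a finite-prime window `[-(log (N+1))/2, (log (N+1))/2]`. [folklore] -/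
theorem exists_window_le_log_succ_half (a : ℝ) : ∃ N : ℕ, a ≤ Real.log ((N : ℝ) + 1) / 2 := by
  refine ⟨⌊Real.exp (2 * a)⌋₊, ?_⟩
  have h1 : Real.exp (2 * a) ≤ (⌊Real.exp (2 * a)⌋₊ : ℝ) + 1 := (Nat.lt_floor_add_one _).le
  have h2 : 2 * a ≤ Real.log ((⌊Real.exp (2 * a)⌋₊ : ℝ) + 1) := by
    rw [Real.le_log_iff_exp_le (by positivity)]
    exact h1
  linarith

/-! ## §3 The autocorrelation of a one-signed real test is nonnegative -/

/-- For real `f`, `(f ⋆ f̃)(y) = ∫ f(u) f(u − y) du` (a real number). [folklore] -/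
theorem weilConv_weilReflect_ofReal (f : ℝ → ℝ) (y : ℝ) :
    weilConv (fun t ↦ (f t : ℂ)) (weilReflect fun t ↦ (f t : ℂ)) y =
      ((∫ u, f u * f (u - y) : ℝ) : ℂ) := by
  have h : ∀ u : ℝ, (fun t ↦ (f t : ℂ)) u * weilReflect (fun t ↦ (f t : ℂ)) (y - u) =
      ((f u * f (u - y) : ℝ) : ℂ) := by
    intro u
    simp only [weilReflect, Complex.conj_ofReal, neg_sub]
    push_cast
    ring
  rw [weilConv_apply]
  simp_rw [h]
  exact integral_ofReal

/-- **`k = f ⋆ f̃ ≥ 0` pointwise for `f ≥ 0`.** [folklore] -/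
theorem re_weilConv_weilReflect_ofReal_nonneg {f : ℝ → ℝ} (hf : ∀ t, 0 ≤ f t) (y : ℝ) :
    0 ≤ (weilConv (fun t ↦ (f t : ℂ)) (weilReflect fun t ↦ (f t : ℂ)) y).re := by
  rw [weilConv_weilReflect_ofReal, Complex.ofReal_re]
  exact integral_nonneg fun u ↦ mul_nonneg (hf u) (hf _)

/-- `Q_w(−g) = Q_w(g)` (`(−g) ⋆ (−g)̃ = g ⋆ g̃`). [folklore] -/
theorem tableDatum_quadratic_neg (w : ℕ → ℝ) (g : ℝ → ℂ) :
    (tableDatum w).quadratic (fun t ↦ -g t) = (tableDatum w).quadratic g := by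
  unfold ExplicitDatum.quadratic
  congr 1
  funext y
  simp only [weilConv_apply, weilReflect, map_neg, mul_neg, neg_mul, neg_neg]

/-! ## §4 Monotonicity of `Re Q` along the down-cone on one-signed tests -/

/-- **Down-cone monotonicity** (nonnegative tests): `w' ≤ w` pointwise and `f ≥ 0` a real window test
`⟹ Re Q_w(f) ≤ Re Q_{w'}(f)`. [folklore] -/
theorem re_quadratic_mono_of_nonneg {w w' : ℕ → ℝ} (hle : ∀ n, w' n ≤ w n) {f : ℝ → ℝ}
    (hf : ∀ t, 0 ≤ f t) (hg : IsWeilTest fun t ↦ (f t : ℂ))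
    (hsupp : tsupport (fun t ↦ (f t : ℂ)) ⊆ Icc (-a) a) :
    ((tableDatum w).quadratic fun t ↦ (f t : ℂ)).re ≤
      ((tableDatum w').quadratic fun t ↦ (f t : ℂ)).re := by
  obtain ⟨N, hN⟩ := exists_window_le_log_succ_half a
  have hsupp' : tsupport (fun t ↦ (f t : ℂ)) ⊆
      Icc (-(Real.log ((N : ℝ) + 1) / 2)) (Real.log ((N : ℝ) + 1) / 2) :=
    hsupp.trans (Icc_subset_Icc (by linarith) hN)
  rw [tableDatum_quadratic_eq_add_sum w w' hg N hsupp', Complex.add_re, Complex.re_sum]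
  have hsum : 0 ≤ ∑ n ∈ Finset.range (N + 1), (((w n - w' n : ℝ) : ℂ) *
      (weilConv (fun t ↦ (f t : ℂ)) (weilReflect fun t ↦ (f t : ℂ)) (Real.log n) +
        weilConv (fun t ↦ (f t : ℂ)) (weilReflect fun t ↦ (f t : ℂ)) (-Real.log n))).re := by
    refine Finset.sum_nonneg fun n _ ↦ ?_
    rw [Complex.re_ofReal_mul, Complex.add_re]
    exact mul_nonneg (sub_nonneg.2 (hle n))
      (add_nonneg (re_weilConv_weilReflect_ofReal_nonneg hf _)
        (re_weilConv_weilReflect_ofReal_nonneg hf _))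
  linarith

/-- A real test and its negative: test-function property and support. [folklore] -/
theorem isWeilTest_neg_ofReal {f : ℝ → ℝ} (hg : IsWeilTest fun t ↦ (f t : ℂ)) :
    IsWeilTest fun t ↦ ((-f t : ℝ) : ℂ) := by
  have e : (fun t ↦ ((-f t : ℝ) : ℂ)) = fun t ↦ (-1 : ℂ) * (f t : ℂ) := by
    funext t; push_cast; ring
  rw [e]
  exact hg.const_mul (-1)

/-- `tsupport (−f) = tsupport f` for real tests cast to `ℂ`. [folklore] -/
theorem tsupport_neg_ofReal (f : ℝ → ℝ) :
    tsupport (fun t ↦ ((-f t : ℝ) : ℂ)) = tsupport fun t ↦ (f t : ℂ) := by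
  have e : (fun t ↦ ((-f t : ℝ) : ℂ)) = -(fun t ↦ (f t : ℂ)) := by
    funext t; push_cast; rfl
  rw [e, tsupport_neg]

/-- **Down-cone monotonicity on ONE-SIGNED real tests**: `w' ≤ w`, `f ≥ 0` or `f ≤ 0`
`⟹ Re Q_w(f) ≤ Re Q_{w'}(f)`. [folklore] -/
theorem re_quadratic_mono_of_oneSigned {w w' : ℕ → ℝ} (hle : ∀ n, w' n ≤ w n) {f : ℝ → ℝ}
    (h1 : (∀ t, 0 ≤ f t) ∨ (∀ t, f t ≤ 0)) (hg : IsWeilTest fun t ↦ (f t : ℂ))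
    (hsupp : tsupport (fun t ↦ (f t : ℂ)) ⊆ Icc (-a) a) :
    ((tableDatum w).quadratic fun t ↦ (f t : ℂ)).re ≤
      ((tableDatum w').quadratic fun t ↦ (f t : ℂ)).re := by
  rcases h1 with hf | hf
  · exact re_quadratic_mono_of_nonneg hle hf hg hsupp
  · have hf' : ∀ t, 0 ≤ -f t := fun t ↦ neg_nonneg.2 (hf t)
    have key := re_quadratic_mono_of_nonneg hle hf' (isWeilTest_neg_ofReal hg)
      (by rw [tsupport_neg_ofReal]; exact hsupp)
    have e : (fun t ↦ ((-f t : ℝ) : ℂ)) = fun t ↦ -((f t : ℂ)) := by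
      funext t; push_cast; rfl
    rwa [e, tableDatum_quadratic_neg, tableDatum_quadratic_neg] at key

/-- **The down-cone of `ζ`, one-signed tests**: `w' ≤ w_ζ ⟹ Re Q_ζ(f) ≤ Re Q_{w'}(f)` for every
one-signed real window test `f`. [folklore] -/
theorem re_weilQuadratic_le_of_oneSigned {w' : ℕ → ℝ} (hle : ∀ n, w' n ≤ zetaTable n) {f : ℝ → ℝ}
    (h1 : (∀ t, 0 ≤ f t) ∨ (∀ t, f t ≤ 0)) (hg : IsWeilTest fun t ↦ (f t : ℂ))
    (hsupp : tsupport (fun t ↦ (f t : ℂ)) ⊆ Icc (-a) a) :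
    (weilQuadratic fun t ↦ (f t : ℂ)).re ≤ ((tableDatum w').quadratic fun t ↦ (f t : ℂ)).re := by
  rw [← tableDatum_zetaTable_quadratic]
  exact re_quadratic_mono_of_oneSigned hle h1 hg hsupp

end Summit.RiemannHypothesis.RiemannHypothesis.Theorems.PfPersistenceDownCone

end
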